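import Literature.MathematicalPhysics.QuantumFieldTheory.Balaban1983to89.T4AvgSensitivity

/-!
# `Balaban1983to89.T4AvgDerivBound` — node O3c of the uniqueness spine RE-TARGETED (cell `pub-balaban`, T4-DAG v3 §2 O3c /
§5 row T4-O3c.E2 / §6 NE1a′): the PER-BOND FIRST- AND SECOND-DIFFERENCE RATES of iterated averaging, TYPED as hypothesis
shapes, and the TOWER CHAIN RULE MODULO GAUGE kernel-checked from the tree's averaging axioms (bookkeeping; `Setup` /
`T4Continuum` / `T4AvgSensitivity` vocabulary)

HONEST FRAMING.  The cell's T4 target is the existence and uniqueness of the continuum limit of Bałaban's unit-scale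
expectations on a finite torus — NOT the Yang–Mills mass gap, NOT the Clay problem.  Node O3c is a leaf of that spine.
Its v2 typing `T4AvgSensitivity.LoopOscBound` (oscillation of a unit-scale loop variable over a fibre, rate `θ_av`) is the
input of the one-step μ-radius sandwich only (`T4OscSandwich`); the referee pass `t4/T4-REF-O3.md` v1 (V3/V5) located that
the SIZE input the dressed bookkeeping (NE1′) consumes is MOMENT-type: the per-fine-bond FIRST-difference rate `θ₁` of
`W_C ∘ avgⁿ` (and a second-difference rate `θ₂`), with the located requirement `L⁴θ₁² ≤ 1 ∧ L⁴θ₁φ ≤ 1`, `φ = L^{−2}`.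
This module TYPES those shapes and ASSERTS NOTHING about Bałaban's averaging operations beyond the two axioms the tree's
`Setup.Averaging` records (gauge covariance, local dependence): `LoopDerivBound`, `LoopPairDerivBound`, `LoopVarBound`,
`AvgStepContraction`, `ReTrLip`, `DomStable`, `GaugeStable`, `FibreConvex` below are HYPOTHESIS SHAPES, consumed only as
hypotheses; every theorem is elementary (inductions on the number of averaging steps, on lists and on finite sets).
Value = typed located estimate + kernel bookkeeping of its structural half; NOT summit progress.

CITATION HEADER (lean-in-tree rule 2026-08-18).  Typed skeleton around T. Bałaban, *Averaging operations for lattice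
gauge theories*, Commun. Math. Phys. **98** (1985) 17–51 [Balaban1985Averaging] (cell paper B7; PDF page = journal
page − 16).  WHAT IS PRINTED and used here (verbatim, read by this seat on the render
`b2b-balaban-ref1/pages/1985-cmp98-averaging/1985-cmp98-averaging-p003-x2.png`):
* p. 19 [PDF 3], (11): "A first condition is connected with the fact that we consider gauge-invariant quantities, so we
  demand that the averaging preserves gauge transformations, i.e., (\overline{U^u})(y, y′) = u(y)Ū(y, y′)u^{−1}(y′), or
  \overline{U^u} = (Ū)^u." (Tree: the axiom `Setup.Averaging.covariant`; iterated from level `k` in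
  `T4AvgSensitivity.iterFrom_gaugeAct`.)  THIS is the printed input of the tower chain rule §4: the coarse gauge
  transformation produced at each level is pushed to the top level by (11) and killed there by gauge invariance of loop
  variables (`T4Continuum.loopAt_gaugeAct_walk`).
* p. 19 [PDF 3], (15): "Ū_c = exp[i Σ_{x∈B(c₋)} L^{−d} (1/i) log U(Γ_{c,x})U(c)^{−1}] U(c)" — the CONTEXT: the one-step
  hypothesis shape `AvgStepContraction av dom θ` (§1) is the cell's typing of the statement "modulo a coarse gauge
  transformation, one averaging step (15) contracts the total variation of a fine-field change by θ on the small-field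
  domain" (estimate NE1a-STEP of the record `t4/T4-EST-O3cE2.md`; NOT PRINTED — [Balaban1985Averaging] Props 1–2,
  p. 26 [PDF 10] ((51), (54) "|Ū^k(∂p) − 1| < α₀ + 2C₀α₀² < 2α₀") are REGULARITY statements "small fine field ⇒ small
  coarse field"; the printed SENSITIVITY statements nearest to NE1a-STEP are first-order derivative bounds — Prop. 3
  p. 36 [PDF 20] ((122)–(126); (126) "|(Q(V₀)A)_c| ≤ |A| + O(1)L²α₀|A|"), Prop. 5 p. 42 [PDF 26] ((156)
  "|δ/δA_b Q_k(U₀, ηA, c)| ≤ 1 + 2C′₁α₀ + C₃|A|", (157)) and the comparison MODULO A GAUGE TRANSFORMATION v_k,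
  (159)–(163) ((163) "|v_k(x) − 1| < O(1)α₁ Σ_{j=0}^{k−1} L^{j+1}η ≤ O(1)α₁"), which is the structural move of `descend`
  (§4) in print.  v1.3 CORRECTION of the v1.2 wording "sup-norm bounds with O(1) constants and NO total-variation
  contraction factor θ < 1": the functional derivative of (156) is NORMALISED by p. 39 [PDF 23] (138) ("the functional
  derivative coincides with partial derivatives (gradient) of F(A) multiplied by η^{−d}"), and U₁ = e^{iηA} (p. 37), so
  in the natural bond angle a = ηA the printed (156) reads ‖∂Q_k(U₀, a, c)/∂a_b‖ ≤ η^{d−1}(1 + 2C′₁α₀ + C₃α₁) =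
  L^{(1−d)k}(…) per Jacobian entry — the RATE θ₁ = L^{1−d} of `LoopDerivBound` (§3) IS PRINTED, per entry, on the
  (158)-box domains around (52)-regular backgrounds (cell record `t4/T4-EST-O3cNE1a.md`, GAPS C-b07g6-1 / G-b07g6-1;
  the flat skeleton ∂Q_k(c)/∂a_b = L^{−kd}·#{x ∈ B^k(c₋) : b ∈ [x, x + L^k e_μ]} ≤ L^{k(1−d)} and its ℓ¹ column sums are
  kernel-checked in the sibling `T4AvgJacobianL1`); what stays NOT PRINTED as typed is the total-variation-modulo-gauge
  ONE-STEP shape `AvgStepContraction` itself (a finite-difference statement on a self-propagating domain) and `DomStable`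
  (v1.2: pointers corrected after XREAD GAPS C-pv20-17 R1; renders p010/p020/p023/p026 read; the contour systems Γ_{c,x}
  are NOT modelled in the tree, DIVERGENCE F6).
NOT used: any other statement of the paper.  Kernel-verified here (bookkeeping, [folklore]): §0 the size `bdist g h =
dist1 (g⁻¹h)` of a one-bond change and the total variation `tv` (symmetry, invariance under inversion, subadditivity
under products, hence `bdist (𝒰_γ(U)) (𝒰_γ(U′)) ≤ Σ_{s∈γ} bdist (U s) (U′ s) ≤ |γ|·tv U U′` — `holAt_bdist_le`,
`loopAt_sub_le`); §2 monotonicity of the shapes and the passages `LoopVarBound → LoopDerivBound`, `LoopVarBound →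
LoopOscBound` (bounded one-bond range); §3 the fibrewise (`Function.update`) form and the TELESCOPING
`LoopDerivBound → LoopVarBound` over a finite set of changed bonds on fibre-convex domains, whence the row's
`loopOscBound_of_loopDerivBound`; §4 **the tower chain rule modulo gauge** `loopVarBound_of_stepContraction`:
`ReTrLip Lip ∧ DomStable ∧ GaugeStable ∧ AvgStepContraction θ ⇒ LoopVarBound av dom Lip θ` at EVERY number of steps
(so the multi-level rate `θ₁` of NE1a′ IS the one-step contraction constant `θ` of NE1a-STEP); §5 the pair shape.

DICTIONARY (cell ↔ this file ↔ print).  Level-`j` configuration `V_j` on `T^{(j)}_η` ↔ `GaugeField P j G`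
([Balaban1985Averaging] (3), (5) p. 18); `n = K − k` averaging steps from level `k` ↔ `T4AvgSensitivity.iterFrom av k n`
([Balaban1985Averaging] (14)–(15) is ONE step; the tree axiomatises a step as `Setup.Averaging`); "size of the change of
`V` at the bond `b`" ↔ `bdist (V b) (V′ b) = dist1 ((V b)⁻¹ * V′ b)` with `dist1` the tree's abstract invariant
distance-to-identity of `Setup.GaugeGroup` (for `G ⊂ U(N)` the cell reads `dist1 g = ‖g − 1‖`; the conversion to
"curvature units" of the level — factors `η^{−2}L^{−2k}`-type — is the instantiation's business and is absorbed in the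
constants); loop variable `W_C = Re tr 𝒰(C)/N` of a closed walk ↔ `loopAt · (walk x w)`; the cell's `θ₁`, `θ₂` ↔ the
rate parameters of `LoopDerivBound` / `LoopPairDerivBound`; the cell's regularity domain ↔ the abstract family `dom`.

THE ROW (T4-DAG v3 §5, verbatim): "| T4-O3c.E2° | O3c | EST | (v3) NE1a RE-TARGETED (T4-REF-O3 V5 / §4 (4)): shape
`LoopDerivBound av C₁ θ₁ (C₂ θ₂)` — for a unit loop C, a k-scale bond b and the fibre {V_k : avg V_k = V_{k+1}} (rest
fixed), the gauge-invariant FIRST difference of W_C(avg^{K−k}V_k) under a one-bond change at b is ≤ C₁·θ₁^{K−k}·(size of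
the change in curvature units), plus a SECOND-difference bound C₂θ₂^{K−k}(·)(·) for two bonds; `.mono/.anti`, trivial
instances, an `updateFinset` lemma, and `loopOscBound_of_loopDerivBound` (osc ≤ Σ_b first differences ⇒ v2's
`LoopOscBound` with ∣Λ∣-linear constant); EST record extending `t4/T4-EST-O3c.md`: expected θ₁ = L^{−3} [analysis],
REQUIRED θ₁ ≤ L^{−2} (L⁴θ₁φ ≤ 1, L⁴θ₁² ≤ 1); domain = the complex Ũ^c-neighbourhoods (X2 (L5)) stated as hypothesis;
natural owner = pv16 lineage (`T4AvgSensitivity`), claimable by anyone | B7 (14)/(15) p.19; T4AvgSensitivity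
(`LoopOscBound`, `iterFrom_agreeOff`, `loopAt_iterFrom_gaugeAct`); T4-EST-O3c §3–§4 | — | M |  | open |".
ON "the fibre {V_k : avg V_k = V_{k+1}} (rest fixed)": as in `LoopOscBound`, the shapes below quantify over ALL pairs of
domain configurations differing at one bond (resp. two bonds), which contains the fibrewise statement (§3 gives the
`Function.update` form the consumers use); ON "trivial instances": a size-weighted shape has NO `(2, 1)`-type trivial
instance (its content includes continuity of `W ∘ avgⁿ` in one bond variable, which the tree's axioms do not give) — the
instance this module provides is the genuine one, §4, from the one-step hypothesis; ON "complex neighbourhoods": the tree's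
configurations are `G`-valued; the complex domains `Ũ^c` of [Balaban1987RG1] (1.11)–(1.16) p. 262 enter only through the
abstract `dom` and the constants (recorded in `t4/T4-EST-O3cE2.md`, not modelled).

EST RECORD (numbers are [analysis]/[toy computation] — findings of the cell seat b07-g5, `t4/T4-EST-O3cE2.md`, GAPS
C-b07g5-4 and C-b07g5-5 — NOT kernel facts and NOT print): in the abelian LINEARISED model of (14)/(15) with the
[Balaban1984PropagatorsI] (1.6)–(1.7) p. 18 block/contour system (the paper's ref. [2]) the exact per-bond
first-derivative rate of the level-`n` plaquette / rectangular-loop angle is `θ₁ = L^{1−d}` per level EXACTLY (`L^{−3}` in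
`d = 4`; 34 cases, exact rationals), the one-step total-variation contraction constant modulo the block gauge
transformation is `θ_step = L^{1−d}` EXACTLY (residual supported on ≤ 2 coarse bonds, ℓ¹ mass exactly `L^{1−d}`; engine
`ne1a_lin_tv.py`), and the ℓ¹-curvature rate is `L^{2−d}` (v2's `θ_av`); the located requirement of T4-REF-O3 V5 is
`θ₁ ≤ L^{−2}` — met with room `L^{−1}` per level by both routes at the abelian linearised level (the total-variation route
of §4 loses only the constant `|w|`, not the rate; v1.1: numbers of this paragraph sharpened, no declaration changed).
Non-abelian corrections
(commutators in (15)), domain propagation ([Balaban1985Averaging] Props 1–2, p. 26) and the reTr/dist1-Lipschitz constant are the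
hypotheses `AvgStepContraction`, `DomStable`, `ReTrLip` of §4 — located, not discharged, ON THE TOTAL-VARIATION ROUTE of §4;
v1.3: for the derivative shape `LoopDerivBound` on (158)-box domains the non-abelian corrections ARE the printed constants
`2C′₁α₀ + C₃α₁` of Prop. 5 (156) read with (138) (record `t4/T4-EST-O3cNE1a.md`: `LoopDerivBound av W Dom
(2·Lip·(1 + 2C′₁α₀ + C₃α₁)) (L^{1−d})`, [cite] + bookkeeping, none of `AvgStepContraction` / `DomStable` / `GaugeStable`
used; this file's theorems are unchanged — v1.3 is docstring-only).  (v1.2, docstring-only: the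
three page pointers to [Balaban1985Averaging] Props 1–2 / 3 / 5 corrected and the printed nearest statements of
NE1a-STEP censused after the cross-read GAPS C-pv20-17 R1; no declaration changed; `ReTrLip G 1` for unitary groups is
meanwhile PROVED in the sibling `T4ReTrLipUnitary`, and the pair bridge to `T4JointDressing.LoopPairOscBound` in
`T4PairDerivBridge`.)

WHAT THIS FILE DOES NOT CLAIM.  Nothing about the actual operations (14)/(15) beyond the tree's two axioms; no value of
`θ₁`, `θ₂`, `θ_step`, `Lip`; nothing about node O3b / NE1′ itself (the consumers `T4OscSandwich`, `T4JointDressing` and the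
paper-level bookkeeping of T4-REF-O3 V4/V5 are untouched); no model of the complex domains.
-/

namespace Literature.MathematicalPhysics.QuantumFieldTheory.Balaban1983to89.T4AvgDerivBound

open Literature.MathematicalPhysics.QuantumFieldTheory.Balaban1983to89
open Literature.MathematicalPhysics.QuantumFieldTheory.Balaban1983to89.T4Continuum
open Literature.MathematicalPhysics.QuantumFieldTheory.Balaban1983to89.T4AvgSensitivity

variable {P : Params} {G : Type*} [GaugeGroup G]

/-! ## §0 The size of a one-bond change and the total variation of a configuration change -/

/-- The SIZE of the change `g ↦ h` of one bond variable: the invariant distance of `g⁻¹h` to the identity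
(`Setup.GaugeGroup.dist1`; for `G ⊂ U(N)`, `‖g − h‖`). [folklore] -/
def bdist (g h : G) : ℝ := dist1 (g⁻¹ * h)

/-- Unfolding. [folklore] -/
theorem bdist_def (g h : G) : bdist g h = dist1 (g⁻¹ * h) := rfl

/-- No change has size zero. [folklore] -/
@[simp] theorem bdist_self (g : G) : bdist g g = 0 := by
  simp [bdist, GaugeGroup.dist1_one]

/-- Sizes are non-negative. [folklore] -/
theorem bdist_nonneg (g h : G) : 0 ≤ bdist g h := GaugeGroup.dist1_nonneg _

/-- Symmetry (`dist1` is inversion invariant). [folklore] -/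
theorem bdist_comm (g h : G) : bdist g h = bdist h g := by
  unfold bdist
  rw [← GaugeGroup.dist1_inv (g⁻¹ * h), mul_inv_rev, inv_inv]

/-- Invariance under inversion of both variables (`dist1` is conjugation invariant): backward steps of a walk change by the
same amount as forward steps. [folklore] -/
theorem bdist_inv_inv (g h : G) : bdist g⁻¹ h⁻¹ = bdist g h := by
  unfold bdist
  rw [inv_inv, ← GaugeGroup.dist1_inv (g * h⁻¹), mul_inv_rev, inv_inv]
  have hconj := GaugeGroup.dist1_conj (g⁻¹ * h) g
  rw [show g * (g⁻¹ * h) * g⁻¹ = h * g⁻¹ by group] at hconj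
  exact hconj

/-- Subadditivity under products: `bdist (g₁g₂) (h₁h₂) ≤ bdist g₁ h₁ + bdist g₂ h₂` (conjugation invariance +
the triangle inequality of `dist1`). [folklore] -/
theorem bdist_mul_mul (g₁ g₂ h₁ h₂ : G) : bdist (g₁ * g₂) (h₁ * h₂) ≤ bdist g₁ h₁ + bdist g₂ h₂ := by
  unfold bdist
  have hsplit : (g₁ * g₂)⁻¹ * (h₁ * h₂) = (g₂⁻¹ * (g₁⁻¹ * h₁) * g₂⁻¹⁻¹) * (g₂⁻¹ * h₂) := by group
  rw [hsplit]
  refine (GaugeGroup.dist1_mul_le _ _).trans ?_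
  rw [GaugeGroup.dist1_conj (g₁⁻¹ * h₁) g₂⁻¹]

/-- The TOTAL VARIATION of a configuration change at level `j`: the sum over all (finitely many) positively oriented bonds
of the sizes of the one-bond changes. [folklore] -/
def tv {j : ℕ} (U U' : GaugeField P j G) : ℝ := ∑ b : PBond P j, bdist (U b) (U' b)

/-- Total variation is non-negative. [folklore] -/
theorem tv_nonneg {j : ℕ} (U U' : GaugeField P j G) : 0 ≤ tv U U' :=
  Finset.sum_nonneg fun b _ => bdist_nonneg (U b) (U' b)

/-- No change: zero total variation. [folklore] -/
@[simp] theorem tv_self {j : ℕ} (U : GaugeField P j G) : tv U U = 0 := by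
  simp [tv]

/-- A single one-bond size is at most the total variation. [folklore] -/
theorem bdist_le_tv {j : ℕ} (U U' : GaugeField P j G) (b : PBond P j) : bdist (U b) (U' b) ≤ tv U U' :=
  Finset.single_le_sum (f := fun c => bdist (U c) (U' c)) (fun c _ => bdist_nonneg (U c) (U' c)) (Finset.mem_univ b)

/-- If two configurations agree off a finite set `Λ` of bonds, the total variation is the sum over `Λ`. [folklore] -/
theorem tv_eq_sum_of_agreeOff {j : ℕ} (Λ : Finset (PBond P j)) (U U' : GaugeField P j G)
    (h : ∀ b, b ∉ Λ → U b = U' b) : tv U U' = ∑ b ∈ Λ, bdist (U b) (U' b) := by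
  unfold tv
  symm
  refine Finset.sum_subset (Finset.subset_univ Λ) fun b _ hb => ?_
  rw [h b hb, bdist_self]

/-- Two configurations agreeing off ONE bond: the total variation is the size of that one change. [folklore] -/
theorem tv_eq_bdist_of_agreeOff_singleton {j : ℕ} (b : PBond P j) (U U' : GaugeField P j G)
    (h : ∀ c, c ≠ b → U c = U' c) : tv U U' = bdist (U b) (U' b) := by
  rw [tv_eq_sum_of_agreeOff {b} U U' fun c hc => h c (by simpa using hc), Finset.sum_singleton]

/-- PARALLEL TRANSPORTS ALONG A FIXED SEQUENCE OF STEPS differ by at most the sum of the sizes of the changes of the bond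
variables met (forward or backward), by `bdist_mul_mul` / `bdist_inv_inv` along the ordered product. [folklore] -/
theorem holAt_bdist_le {j : ℕ} (U U' : GaugeField P j G) :
    ∀ γ : List (LStep P j), bdist (holAt U γ) (holAt U' γ) ≤ (γ.map fun s => bdist (U s.bond) (U' s.bond)).sum
  | [] => by simp [holAt_nil]
  | s :: γ => by
    rw [holAt_cons, holAt_cons, List.map_cons, List.sum_cons]
    refine (bdist_mul_mul _ _ _ _).trans (add_le_add ?_ (holAt_bdist_le U U' γ))
    rcases s with ⟨b, _ | _⟩
    · simp only [Bool.false_eq_true, ↓reduceIte, bdist_inv_inv, le_refl]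
    · simp only [↓reduceIte, le_refl]

/-- … hence by at most `|γ| · tv U U'`. [folklore] -/
theorem holAt_bdist_le_length_mul_tv {j : ℕ} (U U' : GaugeField P j G) (γ : List (LStep P j)) :
    bdist (holAt U γ) (holAt U' γ) ≤ (γ.length : ℝ) * tv U U' := by
  refine (holAt_bdist_le U U' γ).trans ?_
  have h := List.sum_le_card_nsmul (γ.map fun s => bdist (U s.bond) (U' s.bond)) (tv U U') (by
    intro x hx
    obtain ⟨s, _, rfl⟩ := List.mem_map.mp hx
    exact bdist_le_tv U U' s.bond)
  simpa [nsmul_eq_mul] using h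

/-- The walk spelled by a word has as many steps as the word has letters. [folklore] -/
theorem length_walk {j : ℕ} : ∀ (x : Site P j) (w : List (Letter P.d)), (walk x w).length = w.length
  | _, [] => rfl
  | x, (μ, true) :: w => by rw [walk, List.length_cons, List.length_cons, length_walk (x.shift μ) w]
  | x, (μ, false) :: w => by rw [walk, List.length_cons, List.length_cons, length_walk (x.unshift μ) w]

/-! ## §1 Hypothesis shapes -/

/-- HYPOTHESIS SHAPE (property of the model of `G`, NOT of the averaging): the loop-variable function `Re tr(·)/N` is
`Lip`-Lipschitz for the invariant distance, `|reTr g − reTr h| ≤ Lip · dist1 (g⁻¹h)`.  (For `G ⊂ U(N)` with `dist1 g =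
‖g − 1‖` in operator norm and `reTr = Re tr/N` this holds with `Lip = 1` [analysis]; the tree's abstract `GaugeGroup` does
not record it, so it is carried as a hypothesis.) [folklore] -/
def ReTrLip (G : Type*) [GaugeGroup G] (Lip : ℝ) : Prop := ∀ g h : G, |reTr g - reTr h| ≤ Lip * dist1 (g⁻¹ * h)

/-- HYPOTHESIS SHAPE (NE1a-DOM of `t4/T4-EST-O3c.md` §4): the regularity domains propagate up the tower — one averaging
step maps `dom j` into `dom (j+1)` ([Balaban1985Averaging] Props 1–2, p. 26 [PDF 10], (51)/(54) "|Ū^k(∂p) − 1| < α₀ +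
2C₀α₀² < 2α₀, p ⊂ Ω^(k)", are the printed statements of this KIND, "small fine field ⇒ small coarse field"; which
domains and constants is the instantiation's business; v1.2: page pointer corrected, XREAD C-pv20-17 R1). NOT PRINTED as
typed; consumed only as a hypothesis. [cite: Balaban1985Averaging, (15) p.19] -/
def DomStable (av : ∀ j, Averaging P j G) (dom : ∀ j, Set (GaugeField P j G)) : Prop :=
  ∀ j, j + 1 ≤ P.m + P.K → ∀ V : GaugeField P j G, V ∈ dom j → (av j).avg V ∈ dom (j + 1)

/-- HYPOTHESIS SHAPE: the regularity domains are gauge invariant (true for domains defined by plaquette / holonomy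
conditions, [Balaban1987RG1] (1.11)–(1.16) p. 262; abstract here). [folklore] -/
def GaugeStable (dom : ∀ j, Set (GaugeField P j G)) : Prop :=
  ∀ j (u : GaugeTransf P j G) (V : GaugeField P j G), V ∈ dom j → GaugeField.gaugeAct u V ∈ dom j

/-- HYPOTHESIS SHAPE: the regularity domains are FIBRE-CONVEX — a configuration lying bondwise between two domain
configurations (each bond variable equal to one of theirs) is in the domain (true for product domains in bond variables;
for plaquette-defined domains only with a margin — recorded in `t4/T4-EST-O3cE2.md`).  Used only in the telescoping §3.
[folklore] -/
def FibreConvex (dom : ∀ j, Set (GaugeField P j G)) : Prop :=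
  ∀ j (V V' W : GaugeField P j G), V ∈ dom j → V' ∈ dom j → (∀ b, W b = V b ∨ W b = V' b) → W ∈ dom j

/-- HYPOTHESIS SHAPE — NE1a-STEP (cell `pub-balaban`, `t4/T4-EST-O3cE2.md` §2), NOT PRINTED; consumed only as a
hypothesis (§4): ONE averaging step CONTRACTS THE TOTAL VARIATION MODULO A COARSE GAUGE TRANSFORMATION — for domain
configurations `U, U′` of level `j` there is a gauge transformation `u` of `T^{(j+1)}` with
`tv (avg U) ((avg U′)^u) ≤ θ · tv U U′`.  The gauge transformation is essential: at the potential level a root-contour bond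
moves the block variables by `O(1)` (`t4/T4-EST-O3c.md` §3.2: `χ = L^{−d}N(e)δ`, `N(e)` up to `(2/3)L^d`), and only the
residual is small (abelian linearised model, exact: supported on ≤ 2 coarse bonds, ℓ¹ mass exactly `L^{1−d}δ` — finding
of b07-g5, GAPS C-b07g5-4, `t4/T4-EST-O3cE2.md` §2); expected `θ ≤ L^{1−d} + O(ε)` on small-field domains [analysis, NOT
a proof]. [cite: Balaban1985Averaging, (15) p.19] -/
def AvgStepContraction (av : ∀ j, Averaging P j G) (dom : ∀ j, Set (GaugeField P j G)) (θ : ℝ) : Prop :=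
  ∀ j, j + 1 ≤ P.m + P.K → ∀ U U' : GaugeField P j G, U ∈ dom j → U' ∈ dom j →
    ∃ u : GaugeTransf P (j + 1) G, tv ((av j).avg U) (GaugeField.gaugeAct u ((av j).avg U')) ≤ θ * tv U U'

/-- HYPOTHESIS SHAPE — NE1a′ in TOTAL-VARIATION FORM (cell typing, NOT PRINTED; consumed only as a hypothesis by the O3
lineage): for all levels `k`, all `n` with `k + n ≤ m + K`, every closed walk `(x, w)` at level `k + n` and all domain
configurations `V, V′` of level `k`:  `|W(avgⁿ V) − W(avgⁿ V′)| ≤ C · |w| · tv V V′ · θⁿ`.  Implies the one-bond form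
`LoopDerivBound` (§2) and, on domains with bounded one-bond range, v2's `LoopOscBound` (§2); PRODUCED by §4 from
NE1a-STEP. [cite: Balaban1985Averaging, (11) p.19] -/
def LoopVarBound (av : ∀ j, Averaging P j G) (dom : ∀ j, Set (GaugeField P j G)) (C θ : ℝ) : Prop :=
  ∀ (k n : ℕ), k + n ≤ P.m + P.K → ∀ (x : Site P (k + n)) (w : List (Letter P.d)), walkEnd x w = x →
    ∀ (V V' : GaugeField P k G), V ∈ dom k → V' ∈ dom k →
      |loopAt (iterFrom av k n V) (walk x w) - loopAt (iterFrom av k n V') (walk x w)|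
        ≤ C * (w.length : ℝ) * tv V V' * θ ^ n

/-- HYPOTHESIS SHAPE — THE ROW'S `LoopDerivBound av C₁ θ₁` (NE1a′ first differences; cell typing, NOT PRINTED; consumed
only as a hypothesis): for every level-`k` bond `b` and all domain configurations `V, V′` agreeing off `b`, the loop
variable of the `n`-fold average moves by at most `C₁ · |w| · (size of the change at b) · θ₁ⁿ`.  The node text's
"gauge-invariant FIRST difference of W_C(avg^{K−k}V_k) under a one-bond change at b ≤ C₁·θ₁^{K−k}·(size of the change)"
with the loop's length explicit; the left side IS gauge invariant (`T4AvgSensitivity.loopAt_iterFrom_gaugeAct`).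
[cite: Balaban1985Averaging, (11) p.19] -/
def LoopDerivBound (av : ∀ j, Averaging P j G) (dom : ∀ j, Set (GaugeField P j G)) (C₁ θ₁ : ℝ) : Prop :=
  ∀ (k n : ℕ), k + n ≤ P.m + P.K → ∀ (x : Site P (k + n)) (w : List (Letter P.d)), walkEnd x w = x →
    ∀ (b : PBond P k) (V V' : GaugeField P k G), V ∈ dom k → V' ∈ dom k → (∀ c, c ≠ b → V c = V' c) →
      |loopAt (iterFrom av k n V) (walk x w) - loopAt (iterFrom av k n V') (walk x w)|
        ≤ C₁ * (w.length : ℝ) * bdist (V b) (V' b) * θ₁ ^ n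

/-- HYPOTHESIS SHAPE — THE ROW'S SECOND-DIFFERENCE BOUND `C₂ θ₂ (·)(·)` (NE1a′ mixed second differences; cell typing, NOT
PRINTED; consumed only as a hypothesis, e.g. by the pair class of node O3b (ii), `T4JointDressing`): for two distinct
level-`k` bonds `b ≠ b′` and a SQUARE of domain configurations — `V`; `V₁` = `V` changed at `b`; `V₂` = `V` changed at
`b′`; `V₁₂` = both changes — the mixed second difference of the loop variable of the `n`-fold average is at most
`C₂ · |w| · (size at b) · (size at b′) · θ₂ⁿ`.  In the abelian linearised model the averaged FIELD is exactly linear, so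
its own mixed differences vanish and for `W = cos F` the rate is `θ₂ = θ₁²` [analysis]; genuinely bilinear terms of (15)
are non-abelian. [cite: Balaban1985Averaging, (15) p.19] -/
def LoopPairDerivBound (av : ∀ j, Averaging P j G) (dom : ∀ j, Set (GaugeField P j G)) (C₂ θ₂ : ℝ) : Prop :=
  ∀ (k n : ℕ), k + n ≤ P.m + P.K → ∀ (x : Site P (k + n)) (w : List (Letter P.d)), walkEnd x w = x →
    ∀ (b b' : PBond P k), b ≠ b' → ∀ (V V₁ V₂ V₁₂ : GaugeField P k G),
      V ∈ dom k → V₁ ∈ dom k → V₂ ∈ dom k → V₁₂ ∈ dom k →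
      (∀ c, c ≠ b → V₁ c = V c) → (∀ c, c ≠ b' → V₂ c = V c) → (∀ c, c ≠ b → V₁₂ c = V₂ c) → V₁₂ b = V₁ b →
        |loopAt (iterFrom av k n V₁₂) (walk x w) - loopAt (iterFrom av k n V₁) (walk x w)
            - loopAt (iterFrom av k n V₂) (walk x w) + loopAt (iterFrom av k n V) (walk x w)|
          ≤ C₂ * (w.length : ℝ) * bdist (V b) (V₁ b) * bdist (V b') (V₂ b') * θ₂ ^ n

/-! ## §2 Monotonicity and the easy passages between the shapes -/

/-- `LoopVarBound` is monotone in its constants (non-negative target constant). [folklore] -/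
theorem LoopVarBound.mono {av : ∀ j, Averaging P j G} {dom : ∀ j, Set (GaugeField P j G)} {C C' θ θ' : ℝ}
    (h : LoopVarBound av dom C θ) (hC : C ≤ C') (hC' : 0 ≤ C') (hθ0 : 0 ≤ θ) (hθ : θ ≤ θ') :
    LoopVarBound av dom C' θ' := by
  intro k n hn x w hw V V' hV hV'
  refine (h k n hn x w hw V V' hV hV').trans ?_
  have htv := tv_nonneg V V'
  have hw0 : (0 : ℝ) ≤ (w.length : ℝ) := Nat.cast_nonneg _
  have hpow : θ ^ n ≤ θ' ^ n := pow_le_pow_left₀ hθ0 hθ n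
  have hpow0 : 0 ≤ θ ^ n := pow_nonneg hθ0 n
  calc C * (w.length : ℝ) * tv V V' * θ ^ n ≤ C' * (w.length : ℝ) * tv V V' * θ ^ n := by gcongr
    _ ≤ C' * (w.length : ℝ) * tv V V' * θ' ^ n := by gcongr

/-- `LoopVarBound` is antitone in the domain. [folklore] -/
theorem LoopVarBound.anti {av : ∀ j, Averaging P j G} {dom dom' : ∀ j, Set (GaugeField P j G)} {C θ : ℝ}
    (h : LoopVarBound av dom C θ) (hdom : ∀ j, dom' j ⊆ dom j) : LoopVarBound av dom' C θ :=
  fun k n hn x w hw V V' hV hV' => h k n hn x w hw V V' (hdom k hV) (hdom k hV')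

/-- `LoopDerivBound` is monotone in its constants (non-negative target constant). [folklore] -/
theorem LoopDerivBound.mono {av : ∀ j, Averaging P j G} {dom : ∀ j, Set (GaugeField P j G)} {C C' θ θ' : ℝ}
    (h : LoopDerivBound av dom C θ) (hC : C ≤ C') (hC' : 0 ≤ C') (hθ0 : 0 ≤ θ) (hθ : θ ≤ θ') :
    LoopDerivBound av dom C' θ' := by
  intro k n hn x w hw b V V' hV hV' hb
  refine (h k n hn x w hw b V V' hV hV' hb).trans ?_
  have hd := bdist_nonneg (V b) (V' b)
  have hw0 : (0 : ℝ) ≤ (w.length : ℝ) := Nat.cast_nonneg _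
  have hpow : θ ^ n ≤ θ' ^ n := pow_le_pow_left₀ hθ0 hθ n
  have hpow0 : 0 ≤ θ ^ n := pow_nonneg hθ0 n
  calc C * (w.length : ℝ) * bdist (V b) (V' b) * θ ^ n ≤ C' * (w.length : ℝ) * bdist (V b) (V' b) * θ ^ n := by gcongr
    _ ≤ C' * (w.length : ℝ) * bdist (V b) (V' b) * θ' ^ n := by gcongr

/-- `LoopDerivBound` is antitone in the domain. [folklore] -/
theorem LoopDerivBound.anti {av : ∀ j, Averaging P j G} {dom dom' : ∀ j, Set (GaugeField P j G)} {C θ : ℝ}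
    (h : LoopDerivBound av dom C θ) (hdom : ∀ j, dom' j ⊆ dom j) : LoopDerivBound av dom' C θ :=
  fun k n hn x w hw b V V' hV hV' hb => h k n hn x w hw b V V' (hdom k hV) (hdom k hV') hb

/-- `LoopPairDerivBound` is monotone in its constants (non-negative target constant). [folklore] -/
theorem LoopPairDerivBound.mono {av : ∀ j, Averaging P j G} {dom : ∀ j, Set (GaugeField P j G)} {C C' θ θ' : ℝ}
    (h : LoopPairDerivBound av dom C θ) (hC : C ≤ C') (hC' : 0 ≤ C') (hθ0 : 0 ≤ θ) (hθ : θ ≤ θ') :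
    LoopPairDerivBound av dom C' θ' := by
  intro k n hn x w hw b b' hbb' V V₁ V₂ V₁₂ hV hV₁ hV₂ hV₁₂ h₁ h₂ h₁₂ h₁₂b
  refine (h k n hn x w hw b b' hbb' V V₁ V₂ V₁₂ hV hV₁ hV₂ hV₁₂ h₁ h₂ h₁₂ h₁₂b).trans ?_
  have hd := bdist_nonneg (V b) (V₁ b)
  have hd' := bdist_nonneg (V b') (V₂ b')
  have hw0 : (0 : ℝ) ≤ (w.length : ℝ) := Nat.cast_nonneg _
  have hpow : θ ^ n ≤ θ' ^ n := pow_le_pow_left₀ hθ0 hθ n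
  have hpow0 : 0 ≤ θ ^ n := pow_nonneg hθ0 n
  calc C * (w.length : ℝ) * bdist (V b) (V₁ b) * bdist (V b') (V₂ b') * θ ^ n
      ≤ C' * (w.length : ℝ) * bdist (V b) (V₁ b) * bdist (V b') (V₂ b') * θ ^ n := by gcongr
    _ ≤ C' * (w.length : ℝ) * bdist (V b) (V₁ b) * bdist (V b') (V₂ b') * θ' ^ n := by gcongr

/-- `LoopPairDerivBound` is antitone in the domain. [folklore] -/
theorem LoopPairDerivBound.anti {av : ∀ j, Averaging P j G} {dom dom' : ∀ j, Set (GaugeField P j G)} {C θ : ℝ}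
    (h : LoopPairDerivBound av dom C θ) (hdom : ∀ j, dom' j ⊆ dom j) : LoopPairDerivBound av dom' C θ :=
  fun k n hn x w hw b b' hbb' V V₁ V₂ V₁₂ hV hV₁ hV₂ hV₁₂ =>
    h k n hn x w hw b b' hbb' V V₁ V₂ V₁₂ (hdom k hV) (hdom k hV₁) (hdom k hV₂) (hdom k hV₁₂)

/-- The total-variation form gives the one-bond form with the same constants (two configurations agreeing off `b` have
total variation = the size of the change at `b`). [folklore] -/
theorem loopDerivBound_of_loopVarBound {av : ∀ j, Averaging P j G} {dom : ∀ j, Set (GaugeField P j G)} {C θ : ℝ}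
    (h : LoopVarBound av dom C θ) : LoopDerivBound av dom C θ := by
  intro k n hn x w hw b V V' hV hV' hb
  have := h k n hn x w hw V V' hV hV'
  rwa [tv_eq_bdist_of_agreeOff_singleton b V V' hb] at this

/-- The total-variation form gives v2's OSCILLATION form `T4AvgSensitivity.LoopOscBound` with the `|Λ|`-LINEAR constant
`C · D` on domains whose one-bond changes have size at most `D` (e.g. `D = 2 sup dist1` on a small-field ball): two domain
configurations agreeing off `Λ` have total variation `≤ |Λ| · D`. [folklore] -/
theorem loopOscBound_of_loopVarBound {av : ∀ j, Averaging P j G} {dom : ∀ j, Set (GaugeField P j G)} {C θ D : ℝ}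
    (h : LoopVarBound av dom C θ) (hC : 0 ≤ C) (hθ : 0 ≤ θ)
    (hD : ∀ k (V V' : GaugeField P k G), V ∈ dom k → V' ∈ dom k → ∀ b, bdist (V b) (V' b) ≤ D) :
    LoopOscBound av dom (C * D) θ := by
  intro k n hn x w hw Λ V V' hV hV' hΛ
  refine (h k n hn x w hw V V' hV hV').trans ?_
  rw [tv_eq_sum_of_agreeOff Λ V V' hΛ]
  have hsum : ∑ b ∈ Λ, bdist (V b) (V' b) ≤ (Λ.card : ℝ) * D := by
    have := Finset.sum_le_card_nsmul Λ (fun b => bdist (V b) (V' b)) D fun b _ => hD k V V' hV hV' b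
    simpa [nsmul_eq_mul] using this
  have hw0 : (0 : ℝ) ≤ (w.length : ℝ) := Nat.cast_nonneg _
  have hpow0 : 0 ≤ θ ^ n := pow_nonneg hθ n
  calc C * (w.length : ℝ) * (∑ b ∈ Λ, bdist (V b) (V' b)) * θ ^ n
      ≤ C * (w.length : ℝ) * ((Λ.card : ℝ) * D) * θ ^ n := by gcongr
    _ = C * D * (w.length : ℝ) * (Λ.card : ℝ) * θ ^ n := by ring

/-! ## §3 Fibrewise (`Function.update`) form and the telescoping over a finite set of changed bonds -/

/-- FIBREWISE FORM of the one-bond shape: replacing the variable of `V` at `b` by `g` (both configurations in the domain)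
moves the level-`(k+n)` loop variable by at most `C₁ · |w| · bdist (V b) g · θ₁ⁿ` — the form in which a consumer
integrating over one fibre coordinate uses it (`Function.update`, as `T4AvgSensitivity.LoopOscBound.updateFinset`).
[folklore] -/
theorem LoopDerivBound.update {av : ∀ j, Averaging P j G} {dom : ∀ j, Set (GaugeField P j G)} {C₁ θ₁ : ℝ}
    (h : LoopDerivBound av dom C₁ θ₁) {k : ℕ} [DecidableEq (PBond P k)] (n : ℕ) (hn : k + n ≤ P.m + P.K)
    (x : Site P (k + n)) (w : List (Letter P.d)) (hw : walkEnd x w = x) (b : PBond P k)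
    (V : GaugeField P k G) (g : G) (hV : V ∈ dom k) (hV' : Function.update V b g ∈ dom k) :
    |loopAt (iterFrom av k n V) (walk x w) - loopAt (iterFrom av k n (Function.update V b g)) (walk x w)|
      ≤ C₁ * (w.length : ℝ) * bdist (V b) g * θ₁ ^ n := by
  have := h k n hn x w hw b V (Function.update V b g) hV hV' fun c hc => by
    rw [Function.update_of_ne hc]
  simpa only [Function.update_self] using this

/-- TELESCOPING (the row's "osc ≤ Σ_b first differences"): on a FIBRE-CONVEX domain, the one-bond shape bounds the change
of the loop variable under a change of `V` on any finite set `Λ` of bonds by `C₁ · |w| · (Σ_{b∈Λ} sizes) · θ₁ⁿ` — change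
the bonds of `Λ` one at a time (each intermediate configuration is in the domain by fibre-convexity) and add up.
[folklore] -/
theorem LoopDerivBound.sum_of_fibreConvex {av : ∀ j, Averaging P j G} {dom : ∀ j, Set (GaugeField P j G)} {C₁ θ₁ : ℝ}
    (h : LoopDerivBound av dom C₁ θ₁) (hconv : FibreConvex dom) {k : ℕ} (n : ℕ) (hn : k + n ≤ P.m + P.K)
    (x : Site P (k + n)) (w : List (Letter P.d)) (hw : walkEnd x w = x) :
    ∀ (Λ : Finset (PBond P k)) (V V' : GaugeField P k G), V ∈ dom k → V' ∈ dom k → (∀ c, c ∉ Λ → V c = V' c) →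
      |loopAt (iterFrom av k n V) (walk x w) - loopAt (iterFrom av k n V') (walk x w)|
        ≤ C₁ * (w.length : ℝ) * (∑ b ∈ Λ, bdist (V b) (V' b)) * θ₁ ^ n := by
  classical
  intro Λ
  induction Λ using Finset.induction_on with
  | empty =>
    intro V V' _ _ hΛ
    have hVV' : V = V' := funext fun c => hΛ c (by simp)
    subst hVV'
    simp
  | @insert b Λ hb ih =>
    intro V V' hV hV' hΛ
    -- the intermediate configuration: `V` with the bond `b` already changed
    set W : GaugeField P k G := Function.update V b (V' b) with hWdef
    have hWmem : W ∈ dom k := hconv k V V' W hV hV' fun c => by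
      by_cases hc : c = b
      · subst hc; right; simp [hWdef]
      · left; simp [hWdef, Function.update_of_ne hc]
    -- first step: change `b` only
    have h1 : |loopAt (iterFrom av k n V) (walk x w) - loopAt (iterFrom av k n W) (walk x w)|
        ≤ C₁ * (w.length : ℝ) * bdist (V b) (V' b) * θ₁ ^ n := by
      have := h k n hn x w hw b V W hV hWmem fun c hc => by simp [hWdef, Function.update_of_ne hc]
      simpa only [hWdef, Function.update_self] using this
    -- remaining steps: `W` and `V'` agree off `Λ`
    have hWΛ : ∀ c, c ∉ Λ → W c = V' c := fun c hc => by
      by_cases hcb : c = b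
      · subst hcb; simp [hWdef]
      · have hc' : c ∉ insert b Λ := by simp [hcb, hc]
        simp [hWdef, Function.update_of_ne hcb, hΛ c hc']
    have h2 := ih W V' hWmem hV' hWΛ
    have hsumW : ∑ c ∈ Λ, bdist (W c) (V' c) = ∑ c ∈ Λ, bdist (V c) (V' c) := by
      refine Finset.sum_congr rfl fun c hc => ?_
      have hcb : c ≠ b := fun hcb => hb (hcb ▸ hc)
      simp [hWdef, Function.update_of_ne hcb]
    rw [hsumW] at h2
    rw [Finset.sum_insert hb]
    calc |loopAt (iterFrom av k n V) (walk x w) - loopAt (iterFrom av k n V') (walk x w)|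
        ≤ |loopAt (iterFrom av k n V) (walk x w) - loopAt (iterFrom av k n W) (walk x w)|
          + |loopAt (iterFrom av k n W) (walk x w) - loopAt (iterFrom av k n V') (walk x w)| := abs_sub_le _ _ _
      _ ≤ C₁ * (w.length : ℝ) * bdist (V b) (V' b) * θ₁ ^ n
          + C₁ * (w.length : ℝ) * (∑ c ∈ Λ, bdist (V c) (V' c)) * θ₁ ^ n := add_le_add h1 h2
      _ = C₁ * (w.length : ℝ) * (bdist (V b) (V' b) + ∑ c ∈ Λ, bdist (V c) (V' c)) * θ₁ ^ n := by ring

/-- On a fibre-convex domain the one-bond shape gives back the total-variation shape with the same constants. [folklore] -/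
theorem loopVarBound_of_loopDerivBound {av : ∀ j, Averaging P j G} {dom : ∀ j, Set (GaugeField P j G)} {C₁ θ₁ : ℝ}
    (h : LoopDerivBound av dom C₁ θ₁) (hconv : FibreConvex dom) : LoopVarBound av dom C₁ θ₁ := by
  intro k n hn x w hw V V' hV hV'
  have := h.sum_of_fibreConvex hconv n hn x w hw Finset.univ V V' hV hV' fun c hc => absurd (Finset.mem_univ c) hc
  simpa only [tv] using this

/-- **THE ROW'S `loopOscBound_of_loopDerivBound`**: on a fibre-convex domain whose one-bond changes have size at most `D`,
the per-bond first-difference shape with constants `(C₁, θ₁)` implies v2's oscillation shape `LoopOscBound` with the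
`|Λ|`-linear constant `C₁ · D` and the SAME rate `θ₁` ("osc ≤ Σ_b first differences"). [folklore] -/
theorem loopOscBound_of_loopDerivBound {av : ∀ j, Averaging P j G} {dom : ∀ j, Set (GaugeField P j G)} {C₁ θ₁ D : ℝ}
    (h : LoopDerivBound av dom C₁ θ₁) (hconv : FibreConvex dom) (hC : 0 ≤ C₁) (hθ : 0 ≤ θ₁)
    (hD : ∀ k (V V' : GaugeField P k G), V ∈ dom k → V' ∈ dom k → ∀ b, bdist (V b) (V' b) ≤ D) :
    LoopOscBound av dom (C₁ * D) θ₁ :=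
  loopOscBound_of_loopVarBound (loopVarBound_of_loopDerivBound h hconv) hC hθ hD

/-! ## §4 The tower chain rule modulo gauge: NE1a-STEP ⇒ NE1a′ at every number of steps -/

/-- Composition of gauge transformations acts by the pointwise product. [folklore] -/
theorem gaugeAct_gaugeAct {j : ℕ} (u v : GaugeTransf P j G) (V : GaugeField P j G) :
    GaugeField.gaugeAct u (GaugeField.gaugeAct v V) = GaugeField.gaugeAct (fun y => u y * v y) V := by
  funext b
  simp only [GaugeField.gaugeAct, mul_inv_rev]
  group

/-- The pointwise inverse gauge transformation undoes a gauge transformation. [folklore] -/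
theorem gaugeAct_inv_gaugeAct {j : ℕ} (u : GaugeTransf P j G) (V : GaugeField P j G) :
    GaugeField.gaugeAct (fun y => (u y)⁻¹) (GaugeField.gaugeAct u V) = V := by
  funext b
  simp only [GaugeField.gaugeAct]
  group

/-- BASE OF THE INDUCTION (no averaging): under `ReTrLip`, loop variables along a fixed sequence of steps are
`Lip · |γ|`-Lipschitz in total variation. [folklore] -/
theorem loopAt_sub_le {Lip : ℝ} (hLip : ReTrLip G Lip) (hLip0 : 0 ≤ Lip) {j : ℕ} (U U' : GaugeField P j G)
    (γ : List (LStep P j)) : |loopAt U γ - loopAt U' γ| ≤ Lip * ((γ.length : ℝ) * tv U U') := by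
  refine (hLip (holAt U γ) (holAt U' γ)).trans ?_
  exact mul_le_mul_of_nonneg_left (holAt_bdist_le_length_mul_tv U U' γ) hLip0

/-- Domain propagation iterated: `avgⁿ` maps `dom k` into `dom (k+n)` in the standing range. [folklore] -/
theorem iterFrom_mem_dom {av : ∀ j, Averaging P j G} {dom : ∀ j, Set (GaugeField P j G)} (hdom : DomStable av dom)
    {k : ℕ} : ∀ (n : ℕ), k + n ≤ P.m + P.K → ∀ V : GaugeField P k G, V ∈ dom k → iterFrom av k n V ∈ dom (k + n)
  | 0, _, V, hV => by simpa using hV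
  | n + 1, hn, V, hV => by
    rw [iterFrom_succ]
    exact hdom (k + n) (by omega) _ (iterFrom_mem_dom hdom n (by omega) V hV)

/-- THE DESCENT LEMMA: after `n` steps the average of `V′` is GAUGE EQUIVALENT to a domain configuration `Y` whose total
variation from the average of `V` is at most `θⁿ · tv V V′` — at each level the coarse gauge transformation supplied by
`AvgStepContraction` is composed with the one inherited from below (pushed up by [Balaban1985Averaging] (11),
`Setup.Averaging.covariant`). [cite: Balaban1985Averaging, (11) p.19] -/
theorem descend {av : ∀ j, Averaging P j G} {dom : ∀ j, Set (GaugeField P j G)} {θ : ℝ}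
    (hdom : DomStable av dom) (hg : GaugeStable dom) (hstep : AvgStepContraction av dom θ) (hθ : 0 ≤ θ) {k : ℕ} :
    ∀ (n : ℕ), k + n ≤ P.m + P.K → ∀ (V V' : GaugeField P k G), V ∈ dom k → V' ∈ dom k →
      ∃ (Y : GaugeField P (k + n) G) (u : GaugeTransf P (k + n) G),
        Y ∈ dom (k + n) ∧ iterFrom av k n V' = GaugeField.gaugeAct u Y ∧
          tv (iterFrom av k n V) Y ≤ θ ^ n * tv V V'
  | 0, _, V, V', _, hV' => by
    refine ⟨V', fun _ => 1, by simpa using hV', ?_, by simp⟩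
    funext b
    simp [GaugeField.gaugeAct]
  | n + 1, hn, V, V', hV, hV' => by
    obtain ⟨Y, u, hY, hEq, hTV⟩ := descend hdom hg hstep hθ n (by omega) V V' hV hV'
    have hX : iterFrom av k n V ∈ dom (k + n) := iterFrom_mem_dom hdom n (by omega) V hV
    obtain ⟨u', hu'⟩ := hstep (k + n) (by omega) (iterFrom av k n V) Y hX hY
    refine ⟨GaugeField.gaugeAct u' ((av (k + n)).avg Y),
      fun y => u (emb y) * (u' y)⁻¹, hg _ u' _ (hdom (k + n) (by omega) Y hY), ?_, ?_⟩
    · rw [iterFrom_succ, hEq, (av (k + n)).covariant (by omega) u Y, ← gaugeAct_gaugeAct,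
        gaugeAct_inv_gaugeAct]
      rfl
    · rw [iterFrom_succ]
      refine hu'.trans ?_
      rw [pow_succ]
      calc θ * tv (iterFrom av k n V) Y ≤ θ * (θ ^ n * tv V V') := mul_le_mul_of_nonneg_left hTV hθ
        _ = θ ^ n * θ * tv V V' := by ring

/-- **THE TOWER CHAIN RULE MODULO GAUGE** (structural half of NE1a′, kernel): if loop variables are `Lip`-Lipschitz for
the invariant distance (`ReTrLip`), the domains propagate (`DomStable`) and are gauge invariant (`GaugeStable`), and ONE
averaging step contracts total variation modulo a coarse gauge transformation by `θ` (`AvgStepContraction`, NE1a-STEP),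
then for EVERY number `n` of steps the loop variables of the averaged configurations satisfy `LoopVarBound av dom Lip θ`:
`|W(avgⁿ V) − W(avgⁿ V′)| ≤ Lip · |w| · tv V V′ · θⁿ` — the multi-level rate `θ₁` of the row IS the one-step constant.
The gauge transformations never cost anything: [Balaban1985Averaging] (11) pushes them to the top level, where
`loopAt_gaugeAct_walk` removes them. [cite: Balaban1985Averaging, (11) p.19] -/
theorem loopVarBound_of_stepContraction {av : ∀ j, Averaging P j G} {dom : ∀ j, Set (GaugeField P j G)} {Lip θ : ℝ}
    (hLip : ReTrLip G Lip) (hLip0 : 0 ≤ Lip) (hdom : DomStable av dom) (hg : GaugeStable dom)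
    (hstep : AvgStepContraction av dom θ) (hθ : 0 ≤ θ) : LoopVarBound av dom Lip θ := by
  intro k n hn x w hw V V' hV hV'
  obtain ⟨Y, u, _, hEq, hTV⟩ := descend hdom hg hstep hθ n hn V V' hV hV'
  rw [hEq, loopAt_gaugeAct_walk u Y x w hw]
  refine (loopAt_sub_le hLip hLip0 (iterFrom av k n V) Y (walk x w)).trans ?_
  rw [length_walk]
  have hw0 : (0 : ℝ) ≤ (w.length : ℝ) := Nat.cast_nonneg _
  calc Lip * ((w.length : ℝ) * tv (iterFrom av k n V) Y) ≤ Lip * ((w.length : ℝ) * (θ ^ n * tv V V')) := by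
        gcongr
    _ = Lip * (w.length : ℝ) * tv V V' * θ ^ n := by ring

/-- … hence the row's ONE-BOND shape `LoopDerivBound av dom Lip θ` from the one-step hypothesis. [folklore] -/
theorem loopDerivBound_of_stepContraction {av : ∀ j, Averaging P j G} {dom : ∀ j, Set (GaugeField P j G)} {Lip θ : ℝ}
    (hLip : ReTrLip G Lip) (hLip0 : 0 ≤ Lip) (hdom : DomStable av dom) (hg : GaugeStable dom)
    (hstep : AvgStepContraction av dom θ) (hθ : 0 ≤ θ) : LoopDerivBound av dom Lip θ :=
  loopDerivBound_of_loopVarBound (loopVarBound_of_stepContraction hLip hLip0 hdom hg hstep hθ)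

/-- … and v2's OSCILLATION shape `LoopOscBound av dom (Lip · D) θ` on domains with one-bond range `≤ D` — WITHOUT
fibre-convexity (the total-variation route does not telescope bond by bond). [folklore] -/
theorem loopOscBound_of_stepContraction {av : ∀ j, Averaging P j G} {dom : ∀ j, Set (GaugeField P j G)} {Lip θ D : ℝ}
    (hLip : ReTrLip G Lip) (hLip0 : 0 ≤ Lip) (hdom : DomStable av dom) (hg : GaugeStable dom)
    (hstep : AvgStepContraction av dom θ) (hθ : 0 ≤ θ)
    (hD : ∀ k (V V' : GaugeField P k G), V ∈ dom k → V' ∈ dom k → ∀ b, bdist (V b) (V' b) ≤ D) :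
    LoopOscBound av dom (Lip * D) θ :=
  loopOscBound_of_loopVarBound (loopVarBound_of_stepContraction hLip hLip0 hdom hg hstep hθ) hLip0 hθ hD

/-! ## §5 The pair shape: what the first-difference shape gives for free, and what it does not -/

/-- WHAT THE FIRST-DIFFERENCE SHAPE GIVES FOR THE SQUARE: the mixed second difference is at most TWICE the one-bond bound
at `b` (uniformly in the size at `b′`) — `|W(V₁₂) − W(V₁) − W(V₂) + W(V)| ≤ 2 · C₁ · |w| · bdist (V b) (V₁ b) · θ₁ⁿ`.
This is NOT the product form `LoopPairDerivBound` (which is second order in the two sizes and needs `θ₂`, expected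
`θ₁²`): recorded so that consumers see exactly what the pair shape adds. [folklore] -/
theorem mixed_le_two_mul_of_loopDerivBound {av : ∀ j, Averaging P j G} {dom : ∀ j, Set (GaugeField P j G)} {C₁ θ₁ : ℝ}
    (h : LoopDerivBound av dom C₁ θ₁) {k : ℕ} (n : ℕ) (hn : k + n ≤ P.m + P.K) (x : Site P (k + n))
    (w : List (Letter P.d)) (hw : walkEnd x w = x) (b b' : PBond P k) (hbb' : b ≠ b')
    (V V₁ V₂ V₁₂ : GaugeField P k G) (hV : V ∈ dom k) (hV₁ : V₁ ∈ dom k) (hV₂ : V₂ ∈ dom k) (hV₁₂ : V₁₂ ∈ dom k)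
    (h₁ : ∀ c, c ≠ b → V₁ c = V c) (h₂ : ∀ c, c ≠ b' → V₂ c = V c) (h₁₂ : ∀ c, c ≠ b → V₁₂ c = V₂ c)
    (h₁₂b : V₁₂ b = V₁ b) :
    |loopAt (iterFrom av k n V₁₂) (walk x w) - loopAt (iterFrom av k n V₁) (walk x w)
        - loopAt (iterFrom av k n V₂) (walk x w) + loopAt (iterFrom av k n V) (walk x w)|
      ≤ 2 * (C₁ * (w.length : ℝ) * bdist (V b) (V₁ b) * θ₁ ^ n) := by
  -- the two "vertical" sides of the square are one-bond changes at `b` of the same size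
  have hA := h k n hn x w hw b V₂ V₁₂ hV₂ hV₁₂ fun c hc => (h₁₂ c hc).symm
  have hB := h k n hn x w hw b V V₁ hV hV₁ fun c hc => (h₁ c hc).symm
  have hsize : bdist (V₂ b) (V₁₂ b) = bdist (V b) (V₁ b) := by rw [h₁₂b, h₂ b hbb']
  rw [hsize] at hA
  have := add_le_add hA hB
  calc |loopAt (iterFrom av k n V₁₂) (walk x w) - loopAt (iterFrom av k n V₁) (walk x w)
          - loopAt (iterFrom av k n V₂) (walk x w) + loopAt (iterFrom av k n V) (walk x w)|
        = |-(loopAt (iterFrom av k n V₂) (walk x w) - loopAt (iterFrom av k n V₁₂) (walk x w))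
            + (loopAt (iterFrom av k n V) (walk x w) - loopAt (iterFrom av k n V₁) (walk x w))| := by ring_nf
      _ ≤ |-(loopAt (iterFrom av k n V₂) (walk x w) - loopAt (iterFrom av k n V₁₂) (walk x w))|
            + |loopAt (iterFrom av k n V) (walk x w) - loopAt (iterFrom av k n V₁) (walk x w)| := abs_add_le _ _
      _ ≤ 2 * (C₁ * (w.length : ℝ) * bdist (V b) (V₁ b) * θ₁ ^ n) := by rw [abs_neg]; linarith

end Literature.MathematicalPhysics.QuantumFieldTheory.Balaban1983to89.T4AvgDerivBound
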